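import Literature.MathematicalPhysics.QuantumLattice.EuclidLogPotentialSums
import Literature.MathematicalPhysics.QuantumLattice.TorusOutwardNeighbours
import Literature.MathematicalPhysics.QuantumLattice.LatticeToriProofs
import Mathlib.Analysis.SpecialFunctions.Trigonometric.DerivHyp
import HarnessLib

/-!
# The Euclidean truncated logarithmic dipole on the discrete torus `(ℤ/Lℤ)²`

Trunk T-QLATTICE (family `hubbard`; consumer: the sharp Koma–Tasaki `η`-line
`Summits/HubbardSuperconductivity/HubbardLadder/Bounds/PairCorrelationEtaLineEuclid.lean`).

Koma–Tasaki (PRL 68 (1992) 3248, proof of eq. (13), after McBryan–Spencer, CMP 53 (1977) 299)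
optimise the complex-gauge bound with a dipole potential of charges `±q` at `x`, `y` having
P1 `φ_x - φ_y ≈ 2q log|x-y|` and P2: each monopole `u ↦ q log|u|₂` costs
`Σ_{bonds} (cosh ∇φ - 1) ≈ (q²/2) Σ_{bonds} |∇φ|² ≈ (q²/2) Σ_{0<|u|<R} |u|₂⁻² ≈ π q² log R`
per ORIENTED bond family, i.e. `2π q² log R` in the double sum `Σ_u Σ_v` used below. The tree's
`ℓ^∞` dipole (`TorusLogDipole.lean`) pays `8 q² log R` instead (the `ℓ^∞` sphere of radius `s`
is crossed by `8s` bonds, the Euclidean one by `≈ 2πs`). This file builds the EUCLIDEAN profile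
explicitly and proves the sharp constant `2π`, with no lattice Green's function:

* `torusNormSq` — the squared periodic Euclidean norm `a² + b²` (`a, b` the cyclic coordinates);
* `euclidLogProfile N n = ½ log max(1, min(n, N))` and its gradient bound
  `g(n') - g(n) ≤ (n' - n)/(2n)` (`euclidLogProfile_sub_le`);
* `euclidLogMonopole_energy_le` — the monopole `u ↦ q g_{ρ²}(|u - y|²)` has
  `Σ_u Σ_v [u∼v] (cosh(φ_u - φ_v) - 1) ≤ 2π q² H(ρ) + 76 q² + 544 q⁴ e^{2q²}` for `q ≥ 0`,
  uniformly in `L` (`H` = harmonic numbers; along a bond leaving the site with cyclic coordinates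
  `(a,b)`, `n = a²+b²`, in direction `a` the squared norm rises by `2a+1`, at most ONE such bond
  per direction when `a ≥ 1`, and the row-by-row arctangent count of
  `EuclidLogPotentialSums.lean`);
* `exists_euclidLogDipole` — for `1 ≤ ρ`, `2ρ + 1 ≤ dist_∞(x,y)` the dipole has gain
  `φ_x - φ_y = 2q log ρ` and energy at most twice the monopole bound (disjoint supports).

The gain/energy ratio gives the decay exponent `4q - 4π a β|t| q²` in the Koma–Tasaki bound,
whose maximum `1/(π a β|t|)` is the McBryan–Spencer value: with the printed hopping norm
(`a = 1`) the `η = 1/4` line is `T = (π/4)|t|` — no lattice Green's function is needed for the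
upper bound.

Sources: T. Koma, H. Tasaki, PRL 68 (1992) 3248, proof of eq. (13) (P1–P2); O. A. McBryan,
T. Spencer, Commun. Math. Phys. 53 (1977) 299; S. Friedli, Y. Velenik, *Statistical Mechanics
of Lattice Systems* (CUP 2017), Thm 9.12 (the McBryan–Spencer bound with `log`).

## Mathlib search

`Real.cosh_le_cosh`, `Real.log_le_sub_one_of_pos`, `Real.log_div`, `Real.log_pow`,
`Finset.sum_ite_eq`, `Finset.sum_ite_eq'`, `Finset.sum_comm`, `Finset.sum_product`,
`Finset.card_le_card_of_injOn`, `ZMod.val_eq_zero`; tree: `min_val_add_one_le`,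
`torusGraph_adj_iff`, `torusGraph_adj_sub_right_iff`, `torusNorm_two_eq_max`,
`card_filter_cyclicAbs_eq_le`, `torusDist_triangle'`, `torusDist_le_of_adj`.
-/

noncomputable section

namespace Literature.MathematicalPhysics.QuantumLattice

open Finset Literature.Probability.LatticeModels

variable {L : ℕ} [NeZero L]

/-! ### Cyclic coordinates and the squared Euclidean norm -/

omit [NeZero L] in
/-- The squared periodic Euclidean norm `|z|₂² = |z₀|² + |z₁|²` on `(ℤ/Lℤ)²`, where
`|k| = min(k, L - k)` is the cyclic absolute value of the representative. [folklore] -/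
def torusNormSq (z : TorusSite 2 L) : ℕ :=
  (min (z 0).val (L - (z 0).val)) ^ 2 + (min (z 1).val (L - (z 1).val)) ^ 2

omit [NeZero L] in
/-- `‖z‖_∞² ≤ |z|₂²`. [folklore] -/
private theorem torusNorm_sq_le_torusNormSq (z : TorusSite 2 L) : torusNorm z ^ 2 ≤ torusNormSq z := by
  rw [torusNorm_two_eq_max, torusNormSq]
  rcases le_total (min (z 0).val (L - (z 0).val)) (min (z 1).val (L - (z 1).val)) with h | h
  · rw [max_eq_right h]; exact Nat.le_add_left _ _
  · rw [max_eq_left h]; exact Nat.le_add_right _ _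

omit [NeZero L] in
/-- A step `w = z ± e_i` changes the `i`-th coordinate by `±1` and no other. [folklore] -/
private theorem apply_of_step' {z w : TorusSite 2 L} {i : Fin 2}
    (hw : w = z + Pi.single i 1 ∨ z = w + Pi.single i 1) :
    (w i = z i + 1 ∨ z i = w i + 1) ∧ ∀ j, j ≠ i → w j = z j := by
  rcases hw with rfl | rfl
  · exact ⟨Or.inl (by simp), fun j hj => by simp [Pi.single_eq_of_ne hj]⟩
  · exact ⟨Or.inr (by simp), fun j hj => by simp [Pi.single_eq_of_ne hj]⟩

/-- Along `b = a ± 1` the cyclic absolute values differ by at most `1`. [folklore] -/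
private theorem cyclicAbs_step_le' {a b : ZMod L} (h : b = a + 1 ∨ a = b + 1) :
    min b.val (L - b.val) ≤ min a.val (L - a.val) + 1 ∧
      min a.val (L - a.val) ≤ min b.val (L - b.val) + 1 := by
  rcases h with rfl | rfl
  · exact min_val_add_one_le L a
  · exact ⟨(min_val_add_one_le L b).2, (min_val_add_one_le L b).1⟩

/-- The representative of `a + 1`. [folklore] -/
private theorem val_add_one_cases' (a : ZMod L) :
    ((a + 1).val = a.val + 1 ∧ a.val + 1 < L) ∨ ((a + 1).val = 0 ∧ a.val + 1 = L) := by
  have ha : a.val < L := ZMod.val_lt a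
  rcases Nat.lt_or_ge 1 L with hL | hL
  · have h1 : (1 : ZMod L).val = 1 := by
      rw [ZMod.val_one_eq_one_mod, Nat.mod_eq_of_lt hL]
    have hv : (a + 1).val = (a.val + 1) % L := by rw [ZMod.val_add, h1]
    rcases Nat.lt_or_ge (a.val + 1) L with hlt | hge
    · left
      rw [hv, Nat.mod_eq_of_lt hlt]
      exact ⟨rfl, hlt⟩
    · right
      have hEq : a.val + 1 = L := le_antisymm ha hge
      rw [hv, hEq, Nat.mod_self]
      exact ⟨rfl, rfl⟩
  · have hL1 : L = 1 := le_antisymm hL (Nat.one_le_iff_ne_zero.mpr (NeZero.ne L))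
    have hb : (a + 1).val < L := ZMod.val_lt _
    right
    omega

/-- The cyclic absolute value has no strict local minimum with a positive value. [folklore] -/
private theorem cyclicAbs_eq_zero_of_strict_local_min' (b : ZMod L)
    (h1 : min (b + 1).val (L - (b + 1).val) < min b.val (L - b.val))
    (h2 : min (b + 1).val (L - (b + 1).val) < min (b + 1 + 1).val (L - (b + 1 + 1).val)) :
    min (b + 1).val (L - (b + 1).val) = 0 := by
  have hb : b.val < L := ZMod.val_lt b
  have c1 := val_add_one_cases' b
  have c2 := val_add_one_cases' (b + 1)
  omega

/-- **Bond rule for the squared norm.** Along a bond `w = z ± e_i` of `(ℤ/Lℤ)²`, either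
`|w|₂² ≤ |z|₂²`, or the `i`-th cyclic coordinate rises by one, `|w_i| = |z_i| + 1`, and
`|w|₂² = |z|₂² + 2|z_i| + 1`. [folklore] -/
private theorem torusNormSq_step {z w : TorusSite 2 L} {i : Fin 2}
    (hw : w = z + Pi.single i 1 ∨ z = w + Pi.single i 1) :
    torusNormSq w ≤ torusNormSq z ∨
      (min (w i).val (L - (w i).val) = min (z i).val (L - (z i).val) + 1 ∧
        torusNormSq w = torusNormSq z + 2 * min (z i).val (L - (z i).val) + 1) := by
  obtain ⟨hstep, hother⟩ := apply_of_step' hw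
  have hlip := cyclicAbs_step_le' hstep
  have hi2 : i = 0 ∨ i = 1 := by fin_cases i <;> simp
  rcases hi2 with rfl | rfl
  · have h1 : w 1 = z 1 := hother 1 (by decide)
    unfold torusNormSq
    rw [h1]
    rcases Nat.lt_or_ge (min (z 0).val (L - (z 0).val)) (min (w 0).val (L - (w 0).val))
      with h | h
    · right
      have hw0 : min (w 0).val (L - (w 0).val) = min (z 0).val (L - (z 0).val) + 1 := by omega
      refine ⟨hw0, ?_⟩
      rw [hw0]
      ring
    · left
      exact Nat.add_le_add_right (Nat.pow_le_pow_left h 2) _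
  · have h0 : w 0 = z 0 := hother 0 (by decide)
    unfold torusNormSq
    rw [h0]
    rcases Nat.lt_or_ge (min (z 1).val (L - (z 1).val)) (min (w 1).val (L - (w 1).val))
      with h | h
    · right
      have hw1 : min (w 1).val (L - (w 1).val) = min (z 1).val (L - (z 1).val) + 1 := by omega
      refine ⟨hw1, ?_⟩
      rw [hw1]
      ring
    · left
      exact Nat.add_le_add_left (Nat.pow_le_pow_left h 2) _

/-- **At most one outward bond per direction away from the axis**: if `|z_i| ≥ 1` then `z + e_i`
and `z - e_i` cannot both have `i`-th cyclic coordinate `|z_i| + 1`. Koma–Tasaki, PRL 68 (1992)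
3248, proof of eq. (13), property P2 (bond count). [cite: KomaTasakiPRL1992, proof of eq. (13) (P2)] -/
theorem not_both_outward (z : TorusSite 2 L) (i : Fin 2)
    (hz : 1 ≤ min (z i).val (L - (z i).val))
    (h1 : min ((z + Pi.single i 1 : TorusSite 2 L) i).val
        (L - ((z + Pi.single i 1 : TorusSite 2 L) i).val) = min (z i).val (L - (z i).val) + 1)
    (h2 : min ((z - Pi.single i 1 : TorusSite 2 L) i).val
        (L - ((z - Pi.single i 1 : TorusSite 2 L) i).val) = min (z i).val (L - (z i).val) + 1) :
    False := by
  have hp : (z + Pi.single i 1 : TorusSite 2 L) i = z i + 1 := by simp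
  have hm : (z - Pi.single i 1 : TorusSite 2 L) i = z i - 1 := by simp
  rw [hp] at h1
  rw [hm] at h2
  have key := cyclicAbs_eq_zero_of_strict_local_min' (z i - 1)
  simp only [sub_add_cancel] at key
  have := key (by omega) (by omega)
  omega

/-! ### The truncated Euclidean logarithmic profile -/

/-- The profile `g_N(n) = ½ log max(1, min(n, N))` of the truncated Euclidean logarithmic
potential `u ↦ q g_N(|u|₂²)` (`= q log|u|₂` for `1 ≤ |u|₂² ≤ N`). [folklore] -/
def euclidLogProfile (N n : ℕ) : ℝ := Real.log ((max 1 (min n N) : ℕ) : ℝ) / 2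

/-- `g_N(n) = 0` for `n ≤ 1`. [folklore] -/
private theorem euclidLogProfile_of_le_one (N n : ℕ) (hn : n ≤ 1) : euclidLogProfile N n = 0 := by
  unfold euclidLogProfile
  have : max 1 (min n N) = 1 := by omega
  rw [this]
  simp

/-- `g_N` saturates: `g_N(n) = g_N(N)` for `N ≤ n`. [folklore] -/
private theorem euclidLogProfile_of_ge (N n : ℕ) (hn : N ≤ n) :
    euclidLogProfile N n = euclidLogProfile N N := by
  unfold euclidLogProfile
  rw [min_eq_right hn, min_self]

/-- `g_{ρ²}(ρ²) = log ρ` for `ρ ≥ 1`. [folklore] -/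
private theorem euclidLogProfile_sq_self (ρ : ℕ) (hρ : 1 ≤ ρ) :
    euclidLogProfile (ρ ^ 2) (ρ ^ 2) = Real.log ρ := by
  unfold euclidLogProfile
  have h1 : 1 ≤ ρ ^ 2 := Nat.one_le_pow _ _ hρ
  rw [min_self, max_eq_right h1]
  push_cast
  rw [Real.log_pow]
  ring

/-- `g_N` is monotone. [folklore] -/
private theorem euclidLogProfile_mono (N : ℕ) {n n' : ℕ} (h : n ≤ n') :
    euclidLogProfile N n ≤ euclidLogProfile N n' := by
  unfold euclidLogProfile
  refine div_le_div_of_nonneg_right ?_ (by norm_num)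
  refine Real.log_le_log (by positivity) ?_
  exact_mod_cast (show max 1 (min n N) ≤ max 1 (min n' N) by omega)

/-- **Gradient bound**: for `1 ≤ n ≤ n'`, `g_N(n') - g_N(n) ≤ (n' - n)/(2n)`
(`log(n'/n) ≤ n'/n - 1`). [folklore] -/
private theorem euclidLogProfile_sub_le (N : ℕ) {n n' : ℕ} (hn : 1 ≤ n) (h : n ≤ n') :
    euclidLogProfile N n' - euclidLogProfile N n ≤ (((n' : ℝ) - n) / n) / 2 := by
  have hn0 : (0:ℝ) < n := by exact_mod_cast hn
  have hnn' : (n:ℝ) ≤ n' := by exact_mod_cast h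
  rcases Nat.lt_or_ge n N with hN | hN
  swap
  · rw [euclidLogProfile_of_ge N n hN, euclidLogProfile_of_ge N n' (hN.trans h), sub_self]
    have : 0 ≤ ((n':ℝ) - n) / n := div_nonneg (by linarith) hn0.le
    linarith
  · unfold euclidLogProfile
    have hM : max 1 (min n N) = n := by omega
    have hM'1 : 1 ≤ max 1 (min n' N) := le_max_left _ _
    have hM'le : max 1 (min n' N) ≤ n' := by omega
    rw [hM, ← sub_div]
    refine div_le_div_of_nonneg_right ?_ (by norm_num)
    have hpos : (0:ℝ) < ((max 1 (min n' N) : ℕ) : ℝ) := by exact_mod_cast hM'1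
    rw [← Real.log_div hpos.ne' hn0.ne']
    calc Real.log (((max 1 (min n' N) : ℕ) : ℝ) / n)
        ≤ ((max 1 (min n' N) : ℕ) : ℝ) / n - 1 := Real.log_le_sub_one_of_pos (by positivity)
      _ ≤ (n' : ℝ) / n - 1 := by
          gcongr
      _ = ((n' : ℝ) - n) / n := by field_simp

/-! ### Counting sites by their cyclic coordinates -/

/-- Only `0` has cyclic absolute value `0`. [folklore] -/
private theorem card_filter_cyclicAbs_eq_zero_le :
    #{v : ZMod L | min v.val (L - v.val) = 0} ≤ 1 := by
  have hsub : (univ.filter fun v : ZMod L => min v.val (L - v.val) = 0) ⊆ {0} := by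
    intro v hv
    simp only [mem_filter, mem_univ, true_and] at hv
    have hvL := ZMod.val_lt v
    have : v.val = 0 := by omega
    rw [mem_singleton]
    exact (ZMod.val_eq_zero v).1 this
  exact (card_le_card hsub).trans (card_singleton _).le

/-- The number of sites of `(ℤ/Lℤ)²` with prescribed cyclic coordinates `(a, b)` is at most the
`ℤ²`-multiplicity `μ_a μ_b` (`μ_0 = 1`, `μ_k = 2`). [folklore] -/
private theorem card_filter_cyclicCoords_le (a b : ℕ) :
    (#{z : TorusSite 2 L | min (z 0).val (L - (z 0).val) = a ∧
        min (z 1).val (L - (z 1).val) = b} : ℝ) ≤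
      (if a = 0 then (1:ℝ) else 2) * (if b = 0 then (1:ℝ) else 2) := by
  classical
  have hμ : ∀ k : ℕ, (#{v : ZMod L | min v.val (L - v.val) = k} : ℝ) ≤
      (if k = 0 then (1:ℝ) else 2) := by
    intro k
    split_ifs with hk
    · subst hk
      exact_mod_cast (card_filter_cyclicAbs_eq_zero_le (L := L))
    · exact_mod_cast (card_filter_cyclicAbs_eq_le (L := L) k)
  have hprod : #{z : TorusSite 2 L | min (z 0).val (L - (z 0).val) = a ∧
      min (z 1).val (L - (z 1).val) = b} ≤
      #{v : ZMod L | min v.val (L - v.val) = a} * #{v : ZMod L | min v.val (L - v.val) = b} := by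
    rw [← card_product]
    refine card_le_card_of_injOn (fun z => (z 0, z 1)) (fun z hz => ?_) (fun z _ w _ hzw => ?_)
    · simp only [coe_filter, mem_univ, true_and, Set.mem_setOf_eq] at hz
      simp only [coe_product, coe_filter, Set.mem_prod, Set.mem_setOf_eq, mem_univ, true_and]
      exact hz
    · have h0 : z 0 = w 0 := congrArg Prod.fst hzw
      have h1 : z 1 = w 1 := congrArg Prod.snd hzw
      funext j
      have hj : j = 0 ∨ j = 1 := by fin_cases j <;> simp
      rcases hj with rfl | rfl
      · exact h0
      · exact h1
  have hcast : (#{z : TorusSite 2 L | min (z 0).val (L - (z 0).val) = a ∧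
      min (z 1).val (L - (z 1).val) = b} : ℝ) ≤
      (#{v : ZMod L | min v.val (L - v.val) = a} : ℝ) *
        (#{v : ZMod L | min v.val (L - v.val) = b} : ℝ) := by exact_mod_cast hprod
  refine hcast.trans (mul_le_mul (hμ a) (hμ b) (by positivity) ?_)
  split_ifs <;> norm_num

/-! ### The Euclidean logarithmic monopole centred at the origin -/

/-- **Energy of the Euclidean logarithmic monopole (centred at `0`).** On `(ℤ/Lℤ)²`, for
`q ≥ 0` and every radius `ρ`, the potential `ψ(z) = q g_{ρ²}(|z|₂²)` has
`Σ_z Σ_w [z∼w] (cosh(ψ_z - ψ_w) - 1) ≤ 2π q² H(ρ) + 76 q² + 544 q⁴ e^{2q²}`, uniformly in `L`.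
Koma–Tasaki, PRL 68 (1992) 3248, proof of eq. (13), property P2 (`Σ|∇φ|² ≈ (q²/π)log|x-y|` in
their normalisation), after McBryan–Spencer (1977); here with the explicit Euclidean logarithm and
explicit constants. [cite: KomaTasakiPRL1992, proof of eq. (13) (P2)] -/
theorem euclidLogMonopole_energy_le_origin (q : ℝ) (hq : 0 ≤ q) (ρ : ℕ) :
    ∑ z : TorusSite 2 L, ∑ w : TorusSite 2 L,
        (if (torusGraph 2 L).Adj z w then
          (Real.cosh (q * euclidLogProfile (ρ ^ 2) (torusNormSq z) -
              q * euclidLogProfile (ρ ^ 2) (torusNormSq w)) - 1)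
        else 0) ≤
      2 * Real.pi * q ^ 2 * (harmonic ρ : ℝ) + 76 * q ^ 2 + 544 * q ^ 4 * Real.exp (2 * q ^ 2) := by
  classical
  -- the potential as a function of the squared norm, and the outward bond weight
  set P : ℕ → ℝ := fun n => q * euclidLogProfile (ρ ^ 2) n with hP
  have hPmono : ∀ {n n' : ℕ}, n ≤ n' → P n ≤ P n' := fun h =>
    mul_le_mul_of_nonneg_left (euclidLogProfile_mono _ h) hq
  set h : TorusSite 2 L → TorusSite 2 L → ℝ := fun z w =>
    if torusNormSq z < torusNormSq w then Real.cosh (P (torusNormSq w) - P (torusNormSq z)) - 1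
    else 0 with hh
  have hh0 : ∀ z w, 0 ≤ h z w := fun z w => by
    simp only [hh]
    split_ifs
    · exact sub_nonneg.2 (Real.one_le_cosh _)
    · exact le_rfl
  -- (1) the bond term is the outward weight in one of the two directions
  have hedge : ∀ z w, Real.cosh (P (torusNormSq z) - P (torusNormSq w)) - 1 = h z w + h w z := by
    intro z w
    rcases Nat.lt_trichotomy (torusNormSq z) (torusNormSq w) with hlt | heq | hgt
    · simp only [hh, if_pos hlt, if_neg (Nat.lt_asymm hlt), add_zero]
      rw [← Real.cosh_neg, neg_sub]
    · simp only [hh, heq, lt_irrefl, if_false, add_zero, sub_self, Real.cosh_zero]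
    · simp only [hh, if_pos hgt, if_neg (Nat.lt_asymm hgt), zero_add]
  -- (2) symmetrise
  have hsum : (∑ z : TorusSite 2 L, ∑ w : TorusSite 2 L,
      (if (torusGraph 2 L).Adj z w then
        (Real.cosh (P (torusNormSq z) - P (torusNormSq w)) - 1) else 0)) =
      2 * ∑ z : TorusSite 2 L, ∑ w : TorusSite 2 L,
        (if (torusGraph 2 L).Adj z w then h z w else 0) := by
    have hsplit : ∀ z w : TorusSite 2 L,
        (if (torusGraph 2 L).Adj z w then
          (Real.cosh (P (torusNormSq z) - P (torusNormSq w)) - 1) else 0) =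
        (if (torusGraph 2 L).Adj z w then h z w else 0) +
          (if (torusGraph 2 L).Adj w z then h w z else 0) := by
      intro z w
      by_cases hzw : (torusGraph 2 L).Adj z w
      · rw [if_pos hzw, if_pos hzw, if_pos ((torusGraph 2 L).adj_symm hzw), hedge z w]
      · rw [if_neg hzw, if_neg hzw, if_neg (fun h' => hzw ((torusGraph 2 L).adj_symm h')),
          add_zero]
    simp only [hsplit, sum_add_distrib]
    rw [sum_comm (f := fun z w => if (torusGraph 2 L).Adj w z then h w z else 0), two_mul]
  -- (3) the per-site majorant in terms of the cyclic coordinates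
  set G : ℕ → ℕ → ℝ := fun a b =>
    if ¬ (a = 0 ∧ b = 0) ∧ a ^ 2 + b ^ 2 < ρ ^ 2 then
      (if a = 0 then (2:ℝ) else 1) *
          (Real.cosh (q * (2 * a + 1) / (2 * ((a : ℝ) ^ 2 + (b : ℝ) ^ 2))) - 1) +
        (if b = 0 then (2:ℝ) else 1) *
          (Real.cosh (q * (2 * b + 1) / (2 * ((a : ℝ) ^ 2 + (b : ℝ) ^ 2))) - 1)
    else 0 with hG
  have hG0 : ∀ a b, 0 ≤ G a b := fun a b => by
    have h1 : 0 ≤ Real.cosh (q * (2 * a + 1) / (2 * ((a : ℝ) ^ 2 + (b : ℝ) ^ 2))) - 1 :=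
      sub_nonneg.2 (Real.one_le_cosh _)
    have h2 : 0 ≤ Real.cosh (q * (2 * b + 1) / (2 * ((a : ℝ) ^ 2 + (b : ℝ) ^ 2))) - 1 :=
      sub_nonneg.2 (Real.one_le_cosh _)
    have hμa : (0:ℝ) ≤ (if a = 0 then (2:ℝ) else 1) := by by_cases ha : a = 0 <;> simp [ha]
    have hμb : (0:ℝ) ≤ (if b = 0 then (2:ℝ) else 1) := by by_cases hb : b = 0 <;> simp [hb]
    simp only [hG]
    by_cases hc : ¬ (a = 0 ∧ b = 0) ∧ a ^ 2 + b ^ 2 < ρ ^ 2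
    · rw [if_pos hc]
      exact add_nonneg (mul_nonneg hμa h1) (mul_nonneg hμb h2)
    · rw [if_neg hc]
  have hinner : ∀ z : TorusSite 2 L,
      ∑ w : TorusSite 2 L, (if (torusGraph 2 L).Adj z w then h z w else 0) ≤
        G (min (z 0).val (L - (z 0).val)) (min (z 1).val (L - (z 1).val)) := by
    intro z
    set A : ℕ := min (z 0).val (L - (z 0).val) with hAdef
    set B : ℕ := min (z 1).val (L - (z 1).val) with hBdef
    have hnAB : torusNormSq z = A ^ 2 + B ^ 2 := rfl
    have hcoord : ∀ i : Fin 2, min (z i).val (L - (z i).val) ^ 2 ≤ torusNormSq z := by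
      intro i
      have hi2 : i = 0 ∨ i = 1 := by fin_cases i <;> simp
      rcases hi2 with rfl | rfl
      · exact Nat.le_add_right _ _
      · exact Nat.le_add_left _ _
    by_cases hmid : ¬ (A = 0 ∧ B = 0) ∧ A ^ 2 + B ^ 2 < ρ ^ 2
    · -- the generic site `1 ≤ |z|² < ρ²`
      have hn1 : 1 ≤ torusNormSq z := by
        rw [hnAB]
        rcases Nat.eq_zero_or_pos A with hA0 | hA0
        · have hB : B ≠ 0 := fun hB => hmid.1 ⟨hA0, hB⟩
          have : 1 ≤ B := Nat.one_le_iff_ne_zero.2 hB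
          nlinarith
        · nlinarith
      have hnR : ((torusNormSq z : ℕ) : ℝ) = (A : ℝ) ^ 2 + (B : ℝ) ^ 2 := by
        rw [hnAB]; push_cast; ring
      -- weight of one candidate neighbour in direction `i`
      have HW : ∀ (i : Fin 2) (w : TorusSite 2 L),
          (w = z + Pi.single i 1 ∨ z = w + Pi.single i 1) →
            h z w ≤ (if min (w i).val (L - (w i).val) = min (z i).val (L - (z i).val) + 1
              then 1 else 0) *
              (Real.cosh (q * (2 * (min (z i).val (L - (z i).val) : ℕ) + 1) /
                (2 * ((torusNormSq z : ℕ) : ℝ))) - 1) := by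
        intro i w hw
        have hE0 : 0 ≤ Real.cosh (q * (2 * (min (z i).val (L - (z i).val) : ℕ) + 1) /
            (2 * ((torusNormSq z : ℕ) : ℝ))) - 1 := sub_nonneg.2 (Real.one_le_cosh _)
        rcases torusNormSq_step hw with hle | ⟨hup, hn'⟩
        · have : h z w = 0 := by simp only [hh, if_neg (not_lt.2 hle)]
          rw [this]
          split_ifs <;> simp
        · rw [if_pos hup, one_mul]
          have hlt : torusNormSq z < torusNormSq w := by omega
          simp only [hh, if_pos hlt]
          refine sub_le_sub_right (Real.cosh_le_cosh.2 ?_) 1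
          have hdiff0 : 0 ≤ P (torusNormSq w) - P (torusNormSq z) :=
            sub_nonneg.2 (hPmono hlt.le)
          have hbnd : P (torusNormSq w) - P (torusNormSq z) ≤
              q * (2 * (min (z i).val (L - (z i).val) : ℕ) + 1) /
                (2 * ((torusNormSq z : ℕ) : ℝ)) := by
            have hsub := euclidLogProfile_sub_le (ρ ^ 2) hn1 hlt.le
            have hcast : ((torusNormSq w : ℕ) : ℝ) - (torusNormSq z : ℕ) =
                2 * (min (z i).val (L - (z i).val) : ℕ) + 1 := by
              rw [hn']; push_cast; ring
            rw [hcast] at hsub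
            simp only [hP, ← mul_sub]
            calc q * (euclidLogProfile (ρ ^ 2) (torusNormSq w) -
                  euclidLogProfile (ρ ^ 2) (torusNormSq z))
                ≤ q * (((2 * ((min (z i).val (L - (z i).val) : ℕ) : ℝ) + 1) /
                    (torusNormSq z : ℕ)) / 2) := mul_le_mul_of_nonneg_left hsub hq
              _ = q * (2 * (min (z i).val (L - (z i).val) : ℕ) + 1) /
                    (2 * ((torusNormSq z : ℕ) : ℝ)) := by
                  field_simp
          have hrhs0 : 0 ≤ q * (2 * (min (z i).val (L - (z i).val) : ℕ) + 1) /
              (2 * ((torusNormSq z : ℕ) : ℝ)) := by positivity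
          rw [abs_of_nonneg hdiff0, abs_of_nonneg hrhs0]
          exact hbnd
      -- the two candidate neighbours in direction `i`
      have HB : ∀ i : Fin 2, h z (z + Pi.single i 1) + h z (z - Pi.single i 1) ≤
          (if min (z i).val (L - (z i).val) = 0 then (2:ℝ) else 1) *
            (Real.cosh (q * (2 * (min (z i).val (L - (z i).val) : ℕ) + 1) /
              (2 * ((torusNormSq z : ℕ) : ℝ))) - 1) := by
        intro i
        set Ei : ℝ := Real.cosh (q * (2 * (min (z i).val (L - (z i).val) : ℕ) + 1) /
          (2 * ((torusNormSq z : ℕ) : ℝ))) - 1 with hEi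
        have hE0 : 0 ≤ Ei := sub_nonneg.2 (Real.one_le_cosh _)
        have hp := HW i (z + Pi.single i 1) (Or.inl rfl)
        have hm := HW i (z - Pi.single i 1) (Or.inr (by rw [sub_add_cancel]))
        by_cases hzi : min (z i).val (L - (z i).val) = 0
        · rw [if_pos hzi]
          have h1 : h z (z + Pi.single i 1) ≤ Ei := by
            refine hp.trans ?_
            split_ifs
            · exact le_of_eq (one_mul _)
            · rw [zero_mul]; exact hE0
          have h2 : h z (z - Pi.single i 1) ≤ Ei := by
            refine hm.trans ?_
            split_ifs
            · exact le_of_eq (one_mul _)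
            · rw [zero_mul]; exact hE0
          linarith
        · rw [if_neg hzi, one_mul]
          have hzi1 : 1 ≤ min (z i).val (L - (z i).val) := Nat.one_le_iff_ne_zero.2 hzi
          by_cases hup : min ((z + Pi.single i 1 : TorusSite 2 L) i).val
              (L - ((z + Pi.single i 1 : TorusSite 2 L) i).val) =
              min (z i).val (L - (z i).val) + 1
          · have hdown : ¬ min ((z - Pi.single i 1 : TorusSite 2 L) i).val
                (L - ((z - Pi.single i 1 : TorusSite 2 L) i).val) =
                min (z i).val (L - (z i).val) + 1 :=
              fun h2 => not_both_outward z i hzi1 hup h2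
            rw [if_pos hup, one_mul] at hp
            rw [if_neg hdown, zero_mul] at hm
            linarith
          · rw [if_neg hup, zero_mul] at hp
            have h2 : h z (z - Pi.single i 1) ≤ Ei := by
              refine hm.trans ?_
              split_ifs
              · exact le_of_eq (one_mul _)
              · rw [zero_mul]; exact hE0
            linarith
      -- from the adjacency indicator to the four candidate neighbours
      have HA : ∑ w : TorusSite 2 L, (if (torusGraph 2 L).Adj z w then h z w else 0) ≤
          ∑ w : TorusSite 2 L, ∑ i : Fin 2,
            ((if w = z + Pi.single i 1 then h z w else 0) +
              (if w = z - Pi.single i 1 then h z w else 0)) := by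
        refine sum_le_sum fun w _ => ?_
        have hterm0 : ∀ j : Fin 2, 0 ≤ (if w = z + Pi.single j 1 then h z w else 0) +
            (if w = z - Pi.single j 1 then h z w else 0) := fun j =>
          add_nonneg (by split_ifs <;> simp [hh0]) (by split_ifs <;> simp [hh0])
        split_ifs with hzw
        · obtain ⟨-, ⟨i, hi⟩ | ⟨i, hi⟩⟩ := (torusGraph_adj_iff z w).1 hzw
          · refine le_trans ?_ (single_le_sum (fun j _ => hterm0 j) (mem_univ i))
            rw [if_pos hi]
            have : 0 ≤ (if w = z - Pi.single i 1 then h z w else 0) := by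
              split_ifs <;> simp [hh0]
            linarith
          · have hi' : w = z - Pi.single i 1 := by rw [hi, add_sub_cancel_right]
            refine le_trans ?_ (single_le_sum (fun j _ => hterm0 j) (mem_univ i))
            rw [if_pos hi']
            have : 0 ≤ (if w = z + Pi.single i 1 then h z w else 0) := by
              split_ifs <;> simp [hh0]
            linarith
        · exact sum_nonneg fun j _ => hterm0 j
      have HA' : ∑ w : TorusSite 2 L, ∑ i : Fin 2,
          ((if w = z + Pi.single i 1 then h z w else 0) +
            (if w = z - Pi.single i 1 then h z w else 0)) =
          ∑ i : Fin 2, (h z (z + Pi.single i 1) + h z (z - Pi.single i 1)) := by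
        rw [sum_comm]
        refine sum_congr rfl fun i _ => ?_
        rw [sum_add_distrib, sum_ite_eq' univ (z + Pi.single i 1) (h z),
          sum_ite_eq' univ (z - Pi.single i 1) (h z)]
        simp
      -- assemble
      have hGval : G A B = (if A = 0 then (2:ℝ) else 1) *
            (Real.cosh (q * (2 * A + 1) / (2 * ((A : ℝ) ^ 2 + (B : ℝ) ^ 2))) - 1) +
          (if B = 0 then (2:ℝ) else 1) *
            (Real.cosh (q * (2 * B + 1) / (2 * ((A : ℝ) ^ 2 + (B : ℝ) ^ 2))) - 1) := by
        simp only [hG, if_pos hmid]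
      rw [hGval]
      calc ∑ w : TorusSite 2 L, (if (torusGraph 2 L).Adj z w then h z w else 0)
          ≤ ∑ i : Fin 2, (h z (z + Pi.single i 1) + h z (z - Pi.single i 1)) := HA.trans_eq HA'
        _ ≤ ∑ i : Fin 2, (if min (z i).val (L - (z i).val) = 0 then (2:ℝ) else 1) *
              (Real.cosh (q * (2 * (min (z i).val (L - (z i).val) : ℕ) + 1) /
                (2 * ((torusNormSq z : ℕ) : ℝ))) - 1) := sum_le_sum fun i _ => HB i
        _ = _ := by
            rw [Fin.sum_univ_two, hnR]
    · -- the centre and the saturated region: every outward weight vanishes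
      have hGval : G A B = 0 := by simp only [hG, if_neg hmid]
      rw [hGval]
      refine le_of_eq (sum_eq_zero fun w _ => ?_)
      -- the weight of any bond neighbour vanishes
      have hzero : ∀ (i : Fin 2), (w = z + Pi.single i 1 ∨ z = w + Pi.single i 1) →
          h z w = 0 := by
        intro i hw
        rcases torusNormSq_step hw with hle | ⟨-, hn'⟩
        · simp only [hh, if_neg (not_lt.2 hle)]
        · have hlt : torusNormSq z < torusNormSq w := by omega
          simp only [hh, if_pos hlt]
          -- either `|z|² = 0` (then `|w|² = 1`) or `|z|² ≥ ρ²`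
          have hPeq : P (torusNormSq w) = P (torusNormSq z) := by
            rw [not_and_or, not_not, not_lt] at hmid
            rcases hmid with ⟨hA0, hB0⟩ | hbig
            · have hz0 : torusNormSq z = 0 := by rw [hnAB, hA0, hB0]; rfl
              have hci : min (z i).val (L - (z i).val) = 0 := by
                have := hcoord i
                rw [hz0] at this
                exact pow_eq_zero_iff (n := 2) (by norm_num) |>.1 (Nat.le_zero.1 this)
              have hw1 : torusNormSq w = 1 := by rw [hn', hz0, hci]
              simp only [hP, hw1, hz0, euclidLogProfile_of_le_one _ _ le_rfl,
                euclidLogProfile_of_le_one _ _ zero_le_one]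
            · have hzb : ρ ^ 2 ≤ torusNormSq z := by rw [hnAB]; exact hbig
              simp only [hP, euclidLogProfile_of_ge _ _ hzb,
                euclidLogProfile_of_ge _ _ (hzb.trans hlt.le)]
          rw [hPeq, sub_self, Real.cosh_zero, sub_self]
      split_ifs with hzw
      · obtain ⟨-, ⟨i, hi⟩ | ⟨i, hi⟩⟩ := (torusGraph_adj_iff z w).1 hzw
        · exact hzero i (Or.inl hi)
        · exact hzero i (Or.inr hi)
      · rfl
  -- (4) count the sites by their cyclic coordinates
  set μ : ℕ → ℝ := fun k => if k = 0 then (1:ℝ) else 2 with hμ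
  have hμ0 : ∀ k, 0 ≤ μ k := fun k => by by_cases hk : k = 0 <;> simp [hμ, hk]
  set T : Finset (ℕ × ℕ) := range ρ ×ˢ range ρ with hT
  have hcount : ∑ z : TorusSite 2 L, G (min (z 0).val (L - (z 0).val)) (min (z 1).val (L - (z 1).val))
      ≤ ∑ p ∈ T, μ p.1 * μ p.2 * G p.1 p.2 := by
    set c : TorusSite 2 L → ℕ × ℕ := fun z =>
      (min (z 0).val (L - (z 0).val), min (z 1).val (L - (z 1).val)) with hc
    calc ∑ z : TorusSite 2 L, G (min (z 0).val (L - (z 0).val)) (min (z 1).val (L - (z 1).val))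
        = ∑ z : TorusSite 2 L, G (c z).1 (c z).2 := by simp only [hc]
      _ ≤ ∑ z : TorusSite 2 L, ∑ p ∈ T, (if c z = p then G p.1 p.2 else 0) := by
          refine sum_le_sum fun z _ => ?_
          rw [sum_ite_eq]
          split_ifs with hzT
          · exact le_rfl
          · -- outside the box the majorant vanishes
            have : G (c z).1 (c z).2 = 0 := by
              simp only [hG]
              rw [if_neg]
              intro hcond
              apply hzT
              simp only [hT, mem_product, mem_range]
              constructor <;> nlinarith [hcond.2]
            rw [this]
      _ = ∑ p ∈ T, ∑ z : TorusSite 2 L, (if c z = p then G p.1 p.2 else 0) := sum_comm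
      _ = ∑ p ∈ T, G p.1 p.2 * (#{z : TorusSite 2 L | c z = p} : ℝ) := by
          refine sum_congr rfl fun p _ => ?_
          rw [← sum_filter, sum_const, nsmul_eq_mul, mul_comm]
      _ ≤ ∑ p ∈ T, μ p.1 * μ p.2 * G p.1 p.2 := by
          refine sum_le_sum fun p _ => ?_
          have hcard : (#{z : TorusSite 2 L | c z = p} : ℝ) ≤ μ p.1 * μ p.2 := by
            have := card_filter_cyclicCoords_le (L := L) p.1 p.2
            refine le_trans (le_of_eq ?_) this
            congr 2
            ext z
            simp only [mem_filter, mem_univ, true_and, hc, Prod.ext_iff]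
          calc G p.1 p.2 * (#{z : TorusSite 2 L | c z = p} : ℝ)
              ≤ G p.1 p.2 * (μ p.1 * μ p.2) := mul_le_mul_of_nonneg_left hcard (hG0 _ _)
            _ = μ p.1 * μ p.2 * G p.1 p.2 := by ring
  -- (5) the lattice sums
  set Cq : ℝ := q ^ 2 / 2 + 4 * q ^ 4 * Real.exp (2 * q ^ 2) with hCq
  have hCq0 : 0 ≤ Cq := by positivity
  have hpoint : ∀ a b : ℕ, μ a * μ b * G a b ≤
      q ^ 2 / 2 * (if a = 0 ∧ b = 0 then (0:ℝ) else
          μ a * μ b * (((a : ℝ) ^ 2 + (b : ℝ) ^ 2)⁻¹)) +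
        Cq * (if a = 0 ∧ b = 0 then (0:ℝ) else
          μ a * μ b * (((a : ℝ) + b + 1) * ((((a : ℝ) ^ 2 + (b : ℝ) ^ 2) ^ 2)⁻¹))) := by
    intro a b
    by_cases hcond : ¬ (a = 0 ∧ b = 0) ∧ a ^ 2 + b ^ 2 < ρ ^ 2
    · have hGab : G a b = (if a = 0 then (2:ℝ) else 1) *
            (Real.cosh (q * (2 * a + 1) / (2 * ((a : ℝ) ^ 2 + (b : ℝ) ^ 2))) - 1) +
          (if b = 0 then (2:ℝ) else 1) *
            (Real.cosh (q * (2 * b + 1) / (2 * ((a : ℝ) ^ 2 + (b : ℝ) ^ 2))) - 1) := by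
        simp only [hG, if_pos hcond]
      rw [hGab, if_neg hcond.1, if_neg hcond.1]
      have key := two_dir_cosh_sub_one_le q a b hcond.1
      have hμμ : 0 ≤ μ a * μ b := mul_nonneg (hμ0 a) (hμ0 b)
      have := mul_le_mul_of_nonneg_left key hμμ
      refine this.trans (le_of_eq ?_)
      have hn : (0:ℝ) < (a : ℝ) ^ 2 + (b : ℝ) ^ 2 := by
        rcases Nat.eq_zero_or_pos a with ha | ha
        · have hb : 0 < b := Nat.pos_of_ne_zero (fun hb => hcond.1 ⟨ha, hb⟩)
          have hb' : (0:ℝ) < b := by exact_mod_cast hb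
          nlinarith [sq_nonneg (a : ℝ), mul_pos hb' hb']
        · have ha' : (0:ℝ) < a := by exact_mod_cast ha
          nlinarith [sq_nonneg (b : ℝ), mul_pos ha' ha']
      rw [hCq]
      field_simp
    · have hGab : G a b = 0 := by simp only [hG, if_neg hcond]
      rw [hGab, mul_zero]
      have h1 : 0 ≤ (if a = 0 ∧ b = 0 then (0:ℝ) else
          μ a * μ b * (((a : ℝ) ^ 2 + (b : ℝ) ^ 2)⁻¹)) := by
        split_ifs
        · exact le_rfl
        · exact mul_nonneg (mul_nonneg (hμ0 a) (hμ0 b)) (by positivity)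
      have h2 : 0 ≤ (if a = 0 ∧ b = 0 then (0:ℝ) else
          μ a * μ b * (((a : ℝ) + b + 1) * ((((a : ℝ) ^ 2 + (b : ℝ) ^ 2) ^ 2)⁻¹))) := by
        split_ifs
        · exact le_rfl
        · exact mul_nonneg (mul_nonneg (hμ0 a) (hμ0 b)) (by positivity)
      positivity
  have hS1 := sum_sum_inv_normSq_le ρ
  have hS2 := sum_sum_secondary_le ρ
  have hlattice : ∑ p ∈ T, μ p.1 * μ p.2 * G p.1 p.2 ≤
      q ^ 2 / 2 * (2 * Real.pi * (harmonic ρ : ℝ) + 8) + Cq * 68 := by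
    rw [hT, sum_product]
    calc ∑ a ∈ range ρ, ∑ b ∈ range ρ, μ a * μ b * G a b
        ≤ ∑ a ∈ range ρ, ∑ b ∈ range ρ,
            (q ^ 2 / 2 * (if a = 0 ∧ b = 0 then (0:ℝ) else
                μ a * μ b * (((a : ℝ) ^ 2 + (b : ℝ) ^ 2)⁻¹)) +
              Cq * (if a = 0 ∧ b = 0 then (0:ℝ) else
                μ a * μ b * (((a : ℝ) + b + 1) * ((((a : ℝ) ^ 2 + (b : ℝ) ^ 2) ^ 2)⁻¹)))) :=
          sum_le_sum fun a _ => sum_le_sum fun b _ => hpoint a b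
      _ = q ^ 2 / 2 * ∑ a ∈ range ρ, ∑ b ∈ range ρ,
              (if a = 0 ∧ b = 0 then (0:ℝ) else
                μ a * μ b * (((a : ℝ) ^ 2 + (b : ℝ) ^ 2)⁻¹)) +
            Cq * ∑ a ∈ range ρ, ∑ b ∈ range ρ,
              (if a = 0 ∧ b = 0 then (0:ℝ) else
                μ a * μ b * (((a : ℝ) + b + 1) * ((((a : ℝ) ^ 2 + (b : ℝ) ^ 2) ^ 2)⁻¹))) := by
          simp only [sum_add_distrib, mul_sum]
      _ ≤ q ^ 2 / 2 * (2 * Real.pi * (harmonic ρ : ℝ) + 8) + Cq * 68 := by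
          have hq2 : 0 ≤ q ^ 2 / 2 := by positivity
          simp only [hμ] at hS1 hS2 ⊢
          exact add_le_add (mul_le_mul_of_nonneg_left hS1 hq2)
            (mul_le_mul_of_nonneg_left hS2 hCq0)
  -- (6) conclusion
  rw [hsum]
  calc 2 * ∑ z : TorusSite 2 L, ∑ w : TorusSite 2 L,
        (if (torusGraph 2 L).Adj z w then h z w else 0)
      ≤ 2 * ∑ z : TorusSite 2 L,
          G (min (z 0).val (L - (z 0).val)) (min (z 1).val (L - (z 1).val)) := by
        gcongr with z
        exact hinner z
    _ ≤ 2 * (q ^ 2 / 2 * (2 * Real.pi * (harmonic ρ : ℝ) + 8) + Cq * 68) := by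
        gcongr
        exact hcount.trans hlattice
    _ = 2 * Real.pi * q ^ 2 * (harmonic ρ : ℝ) + 76 * q ^ 2 +
          544 * q ^ 4 * Real.exp (2 * q ^ 2) := by
        rw [hCq]
        ring

/-! ### The monopole at a general centre and the dipole -/

/-- **Energy of the Euclidean logarithmic monopole** centred at any site `y` of `(ℤ/Lℤ)²`:
for `q ≥ 0` and every `ρ`, `φ^{(y)}(u) = q g_{ρ²}(|u - y|₂²)` has
`Σ_u Σ_v [u∼v] (cosh(φ_u - φ_v) - 1) ≤ 2π q² H(ρ) + 76 q² + 544 q⁴ e^{2q²}`, uniformly in `L`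
(translation of `euclidLogMonopole_energy_le_origin`). Koma–Tasaki, PRL 68 (1992) 3248, proof
of eq. (13), P2. [cite: KomaTasakiPRL1992, proof of eq. (13) (P2)] -/
theorem euclidLogMonopole_energy_le (L : ℕ) [NeZero L] (y : TorusSite 2 L) (q : ℝ)
    (hq : 0 ≤ q) (ρ : ℕ) :
    ∑ u : TorusSite 2 L, ∑ v : TorusSite 2 L,
        (if (torusGraph 2 L).Adj u v then
          (Real.cosh (q * euclidLogProfile (ρ ^ 2) (torusNormSq (u - y)) -
              q * euclidLogProfile (ρ ^ 2) (torusNormSq (v - y))) - 1)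
        else 0) ≤
      2 * Real.pi * q ^ 2 * (harmonic ρ : ℝ) + 76 * q ^ 2 + 544 * q ^ 4 * Real.exp (2 * q ^ 2) := by
  classical
  have htrans : (∑ u : TorusSite 2 L, ∑ v : TorusSite 2 L,
      (if (torusGraph 2 L).Adj u v then
        (Real.cosh (q * euclidLogProfile (ρ ^ 2) (torusNormSq (u - y)) -
            q * euclidLogProfile (ρ ^ 2) (torusNormSq (v - y))) - 1)
      else 0)) =
      ∑ z : TorusSite 2 L, ∑ w : TorusSite 2 L,
        (if (torusGraph 2 L).Adj z w then
          (Real.cosh (q * euclidLogProfile (ρ ^ 2) (torusNormSq z) -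
              q * euclidLogProfile (ρ ^ 2) (torusNormSq w)) - 1)
        else 0) := by
    refine Fintype.sum_equiv (Equiv.subRight y) _ _ fun u => ?_
    refine Fintype.sum_equiv (Equiv.subRight y) _ _ fun v => ?_
    simp only [Equiv.subRight_apply, torusGraph_adj_sub_right_iff]
  rw [htrans]
  exact euclidLogMonopole_energy_le_origin q hq ρ

/-- **The Euclidean truncated logarithmic dipole.** On `(ℤ/Lℤ)²`, for sites `x, y`, a charge
`q ≥ 0` and a radius `ρ ≥ 1` with `2ρ + 1 ≤ dist_∞(x,y)`, the dipole
`φ = φ^{(y)} - φ^{(x)}`, `φ^{(c)}(u) = q g_{ρ²}(|u - c|₂²)`, has gain `φ_x - φ_y = 2q log ρ` and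
energy `Σ_u Σ_v [u∼v] (cosh(φ_u - φ_v) - 1) ≤ 2 (2π q² H(ρ) + 76 q² + 544 q⁴ e^{2q²})`: the two
monopoles vary on disjoint sets of bonds (`ℓ^∞`-balls of radius `ρ` about `y` and `x`), so the
energies add. Koma–Tasaki, PRL 68 (1992) 3248, proof of eq. (13) (the dipole with P1
`φ_x - φ_y ≈ (q/π) log|x-y|` and P2 `Σ|∇φ|² ≈ (q²/π) log|x-y|` in their normalisation), following
McBryan–Spencer (1977); here the explicit Euclidean-logarithm version with the sharp `2π`.
[cite: KomaTasakiPRL1992, proof of eq. (13) (P1–P2)] -/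
theorem exists_euclidLogDipole (L : ℕ) [NeZero L] (x y : TorusSite 2 L) (q : ℝ) (hq : 0 ≤ q)
    (ρ : ℕ) (hρ1 : 1 ≤ ρ) (hρ : 2 * ρ + 1 ≤ torusDist x y) :
    ∃ φ : TorusSite 2 L → ℝ, φ x - φ y = 2 * q * Real.log ρ ∧
      ∑ u : TorusSite 2 L, ∑ v : TorusSite 2 L,
          (if (torusGraph 2 L).Adj u v then (Real.cosh (φ u - φ v) - 1) else 0) ≤
        2 * (2 * Real.pi * q ^ 2 * (harmonic ρ : ℝ) + 76 * q ^ 2 +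
          544 * q ^ 4 * Real.exp (2 * q ^ 2)) := by
  classical
  set A : TorusSite 2 L → ℝ := fun u => q * euclidLogProfile (ρ ^ 2) (torusNormSq (u - y))
    with hA
  set B : TorusSite 2 L → ℝ := fun u => q * euclidLogProfile (ρ ^ 2) (torusNormSq (u - x))
    with hB
  -- squared norm versus `ℓ^∞` distance
  have hsq : ∀ u c : TorusSite 2 L, torusDist u c ^ 2 ≤ torusNormSq (u - c) := fun u c =>
    torusNorm_sq_le_torusNormSq (u - c)
  have hsat : ∀ u c : TorusSite 2 L, ρ ≤ torusDist u c →
      euclidLogProfile (ρ ^ 2) (torusNormSq (u - c)) = Real.log ρ := by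
    intro u c huc
    have h2 : ρ ^ 2 ≤ torusNormSq (u - c) :=
      (Nat.pow_le_pow_left huc 2).trans (hsq u c)
    rw [euclidLogProfile_of_ge _ _ h2, euclidLogProfile_sq_self ρ hρ1]
  refine ⟨fun u => A u - B u, ?_, ?_⟩
  · -- gain
    have hxy : ρ ≤ torusDist x y := by omega
    have hyx : ρ ≤ torusDist y x := by rw [torusDist_comm']; exact hxy
    have hAx : A x = q * Real.log ρ := by simp only [hA, hsat x y hxy]
    have hBy : B y = q * Real.log ρ := by simp only [hB, hsat y x hyx]
    have hAy : A y = 0 := by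
      simp only [hA, sub_self]
      rw [show torusNormSq (0 : TorusSite 2 L) = 0 by simp [torusNormSq],
        euclidLogProfile_of_le_one _ _ zero_le_one, mul_zero]
    have hBx : B x = 0 := by
      simp only [hB, sub_self]
      rw [show torusNormSq (0 : TorusSite 2 L) = 0 by simp [torusNormSq],
        euclidLogProfile_of_le_one _ _ zero_le_one, mul_zero]
    show (A x - B x) - (A y - B y) = 2 * q * Real.log ρ
    rw [hAx, hBy, hAy, hBx]
    ring
  · -- energy: bondwise splitting on disjoint supports
    have hsplit : ∀ u v, (torusGraph 2 L).Adj u v →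
        Real.cosh ((A u - B u) - (A v - B v)) - 1 =
          (Real.cosh (A u - A v) - 1) + (Real.cosh (B u - B v) - 1) := by
      intro u v huv
      have hre : (A u - B u) - (A v - B v) = (A u - A v) - (B u - B v) := by ring
      rw [hre]
      by_cases hfar : ρ ≤ torusDist u y ∧ ρ ≤ torusDist v y
      · -- outside the ball about `y` the `y`-monopole is constant
        have hA0 : A u - A v = 0 := by
          simp only [hA, hsat u y hfar.1, hsat v y hfar.2, sub_self]
        rw [hA0, zero_sub, Real.cosh_neg, Real.cosh_zero, sub_self, zero_add]
      · -- the bond meets the ball of radius `ρ` about `y`, hence not the one about `x`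
        have hd := torusDist_le_of_adj L huv y
        have huy : torusDist u y ≤ ρ := by omega
        have hvy : torusDist v y ≤ ρ := by omega
        have htu := torusDist_triangle' x u y
        have htv := torusDist_triangle' x v y
        rw [torusDist_comm' x u] at htu
        rw [torusDist_comm' x v] at htv
        have hux : ρ ≤ torusDist u x := by omega
        have hvx : ρ ≤ torusDist v x := by omega
        have hB0 : B u - B v = 0 := by
          simp only [hB, hsat u x hux, hsat v x hvx, sub_self]
        rw [hB0, sub_zero, Real.cosh_zero, sub_self, add_zero]
    have hmonoY := euclidLogMonopole_energy_le L y q hq ρ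
    have hmonoX := euclidLogMonopole_energy_le L x q hq ρ
    calc ∑ u : TorusSite 2 L, ∑ v : TorusSite 2 L,
          (if (torusGraph 2 L).Adj u v then (Real.cosh ((A u - B u) - (A v - B v)) - 1) else 0)
        = ∑ u : TorusSite 2 L, ∑ v : TorusSite 2 L,
            ((if (torusGraph 2 L).Adj u v then (Real.cosh (A u - A v) - 1) else 0) +
              (if (torusGraph 2 L).Adj u v then (Real.cosh (B u - B v) - 1) else 0)) := by
          refine sum_congr rfl fun u _ => sum_congr rfl fun v _ => ?_
          split_ifs with huv
          · exact hsplit u v huv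
          · simp
      _ = (∑ u : TorusSite 2 L, ∑ v : TorusSite 2 L,
            (if (torusGraph 2 L).Adj u v then (Real.cosh (A u - A v) - 1) else 0)) +
          ∑ u : TorusSite 2 L, ∑ v : TorusSite 2 L,
            (if (torusGraph 2 L).Adj u v then (Real.cosh (B u - B v) - 1) else 0) := by
          simp only [sum_add_distrib]
      _ ≤ _ := by
          have := add_le_add hmonoY hmonoX
          simpa [hA, hB, two_mul] using this

end Literature.MathematicalPhysics.QuantumLattice

end
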